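import Mathlib
import Summits.ResolutionOfSingularities.ResolutionOfSingularities.Theorems.WeightedInvariantLocalWeightedDropNCResBadDirForms
import Summits.ResolutionOfSingularities.ResolutionOfSingularities.Theorems.WeightedInvariantLocalWeightedDropNCResBadDirLevel

/-!
# `WeightedInvariant.LocalWeightedDrop`: the TOT₂ line, regime (B) «letters in bad position» — THE POINT LOOP

Crux item stmt-ResolutionOfSingularities-8899 `LocalWeightedDrop` (route `ResolutionOfSingularities/WeightedInvariant`), ENGINE skeleton v33
(res-L1-w43-lead-1 g5, TOT2-LINE v1.3 §1–§3 (B)), registered regime stub `stub_regimeBad` (deal → res-type-056).  [OURS · L1 W4.3 · chain w43 · seat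
res-type-056; def-free; the count game is the programme's own; nothing here is a statement of any manuscript; AI-produced, gate-checked, weaker than
expert review.]

WHAT.  Three letters, an admissibly decorated state `(b, δ)` with `o ≥ 2`, empty history and a DIRECTRIX FORM `ℓ` supported on boundary letters,
`S := supp ℓ`, with either `|S| = 3`, or `|S| = 2` and a FAILING INTEGER LEVEL `r` of `f` along the free letter's axis `C = ⋂_{l∈S} V(x_l)`
(`f ∉ (x_S)^o` — the permissible-curve case is the sibling file).  THE DIRECTOR WINS TO «head drop, or same head in the apex column (H) or in good
position (P-good)» (`dWinsTo_exit_of_badDir_level`) by IDENTITY POINT BLOW-UPS ONLY, with the measure `0` (`|S| = 3`) / `r + 1` (`|S| = 2`):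
at an answer `(c, i)` with the same head the answer lies in the directrix plane (`ℓ · c = 0`, …NCResBadDirForms) and a directrix form `ℓ′` of the
transform (if it is not in the apex column) has `ℓ′_{p⁺} = 0 ↔ ℓ_{i.succAbove p} = 0`; so (a) if some `l ≠ i` has `ℓ_l ≠ 0 ≠ c_l` the new
coordinate `y_l` is not a boundary letter and occurs in `ℓ′`: GOOD POSITION; (b) otherwise `ℓ_i = 0`, `|S| = 2`, `i` is the free letter and `c`
the AXIS POINT: the transform is again in bad position with `S′ ⊇ {1, 2}` through-going, and either `ℓ′_s ≠ 0` (`|S′| = 3`, measure `0`) or the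
level drops by one (…NCResBadDirLevel).  (B) → (B) transitions DO occur (e.g. `f = (y+z)² + x⁵`, answer `(1:0:0)`), which is why the level is
carried.
-/

set_option linter.dupNamespace false -- mandated namespace of this single-conjunct summit

noncomputable section

namespace Summit.ResolutionOfSingularities.ResolutionOfSingularities.Theorems

namespace TameFourTupleDrop

namespace NCResBad

open MvPowerSeries Literature.AlgebraicGeometry.Resolution GraphCurve TOT2E1

variable {k : Type} [Field k]

/-- All monomials of `f` have degree at least `o`. -/
theorem o_le_degree_of_coeff_ne_zero (δ : Decoration k 2) (hf : δ.f ≠ 0) {E : Fin (2 + 1) →₀ ℕ} (hE : coeff E δ.f ≠ 0) :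
    δ.o ≤ E.degree := by
  have hfin : δ.f.order ≠ ⊤ := by rw [ne_eq, order_eq_top_iff]; exact hf
  have h : ((δ.o : ℕ) : ℕ∞) ≤ (E.degree : ℕ∞) := by
    rw [Decoration.o, ENat.coe_toNat hfin]
    by_contra hlt
    exact hE (coeff_of_lt_order (not_le.mp hlt))
  exact_mod_cast h

/-- In three letters, the directrix plane through an answer: if every `l ≠ i` with `ℓ_l ≠ 0` has `c_l = 0`, then `ℓ · c = ℓ_i c_i`. -/
theorem dotProduct_eq_single_term {n : ℕ} {ℓ c : Fin n → k} {i : Fin n} (h : ∀ l, l ≠ i → ℓ l ≠ 0 → c l = 0) :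
    dotProduct ℓ c = ℓ i * c i := by
  rw [dotProduct]
  refine Finset.sum_eq_single i (fun l _ hl => ?_) (fun hi => absurd (Finset.mem_univ i) hi)
  by_cases hℓ : ℓ l = 0
  · rw [hℓ, zero_mul]
  · rw [h l hl hℓ, mul_zero]

/-- **THE POINT LOOP OF REGIME (B).**  Three letters, `k` infinite.  From an admissibly decorated state with `o ≥ 2`, empty history, a
directrix form `ℓ` supported on boundary letters, and either FULL support or support of size two with a failing integer level of `f` along the
free letter, the director wins to «admissibly decorated, and: head drop, or same head with apex column or good position» — by identity point
blow-ups. -/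
theorem dWinsTo_exit_of_badDir_level [Infinite k] {b : MvPowerSeries (Fin (2 + 1)) k} {δ : Decoration k 2} (hadm : Admissible b δ)
    (ho : 2 ≤ δ.o) (hO : δ.O = ∅) {ℓ : Fin (2 + 1) → k} (hℓ : δ.IsDirForm ℓ) (hsupp : ∀ j, ℓ j ≠ 0 → j ∈ δ.E)
    (hdata : (∀ j, ℓ j ≠ 0) ∨ ∃ j, ℓ j = 0 ∧ (∀ l, l ≠ j → ℓ l ≠ 0) ∧
      ∃ r : ℕ, ¬ (∀ E : Fin (2 + 1) →₀ ℕ, offDeg j E < δ.o → E j < r * (δ.o - offDeg j E) → coeff E δ.f = 0)) :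
    DWinsTo (St := MvPowerSeries (Fin (2 + 1)) k × Decoration k 2) Prod.fst
      (fun τ => Admissible τ.1 τ.2 ∧ (τ.2.head < δ.head ∨ (τ.2.head = δ.head ∧ (τ.2.HCol ∨ τ.2.GoodDir)))) (b, δ) := by
  classical
  -- the two kinds of states of the loop
  set Full : (MvPowerSeries (Fin (2 + 1)) k × Decoration k 2) → Prop := fun τ =>
    ∃ ℓ : Fin (2 + 1) → k, τ.2.IsDirForm ℓ ∧ (∀ j, ℓ j ≠ 0 → j ∈ τ.2.E) ∧ ∀ j, ℓ j ≠ 0 with hFull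
  set Two : (MvPowerSeries (Fin (2 + 1)) k × Decoration k 2) → ℕ → Prop := fun τ r =>
    ∃ (ℓ : Fin (2 + 1) → k) (j : Fin (2 + 1)), τ.2.IsDirForm ℓ ∧ (∀ j, ℓ j ≠ 0 → j ∈ τ.2.E) ∧ ℓ j = 0 ∧ (∀ l, l ≠ j → ℓ l ≠ 0) ∧
      ¬ (∀ E : Fin (2 + 1) →₀ ℕ, offDeg j E < τ.2.o → E j < r * (τ.2.o - offDeg j E) → coeff E τ.2.f = 0) with hTwo
  set Cl : Set (MvPowerSeries (Fin (2 + 1)) k × Decoration k 2) :=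
    {τ | Admissible τ.1 τ.2 ∧ τ.2.head = δ.head ∧ τ.2.O = ∅ ∧ (Full τ ∨ ∃ r, Two τ r)} with hCl
  set μ : (MvPowerSeries (Fin (2 + 1)) k × Decoration k 2) → Ordinal.{0} := fun τ =>
    ((sInf {N : ℕ | (Full τ ∧ N = 0) ∨ ∃ r, Two τ r ∧ N = r + 1} : ℕ) : Ordinal.{0}) with hμ
  -- measure bookkeeping
  have hμ_le_Full : ∀ τ, Full τ → μ τ = 0 := by
    intro τ h
    have hmem : (0 : ℕ) ∈ {N : ℕ | (Full τ ∧ N = 0) ∨ ∃ r, Two τ r ∧ N = r + 1} := Or.inl ⟨h, rfl⟩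
    have h0 : sInf {N : ℕ | (Full τ ∧ N = 0) ∨ ∃ r, Two τ r ∧ N = r + 1} = 0 := Nat.eq_zero_of_le_zero (Nat.sInf_le hmem)
    simp only [hμ, h0, Nat.cast_zero]
  have hμ_le_Two : ∀ τ r, Two τ r → μ τ ≤ ((r + 1 : ℕ) : Ordinal.{0}) := by
    intro τ r h
    have hmem : r + 1 ∈ {N : ℕ | (Full τ ∧ N = 0) ∨ ∃ r, Two τ r ∧ N = r + 1} := Or.inr ⟨r, h, rfl⟩
    exact Nat.cast_le.mpr (Nat.sInf_le hmem)
  have hμ_eq : ∀ τ, (Full τ ∨ ∃ r, Two τ r) → (Full τ ∧ μ τ = 0) ∨ ∃ r, Two τ r ∧ μ τ = ((r + 1 : ℕ) : Ordinal.{0}) := by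
    rintro τ hcase
    have hne : ({N : ℕ | (Full τ ∧ N = 0) ∨ ∃ r, Two τ r ∧ N = r + 1} : Set ℕ).Nonempty := by
      rcases hcase with h | ⟨r, h⟩
      · exact ⟨0, Or.inl ⟨h, rfl⟩⟩
      · exact ⟨r + 1, Or.inr ⟨r, h, rfl⟩⟩
    rcases Nat.sInf_mem hne with ⟨hF, h0⟩ | ⟨r, hr, hN⟩
    · exact Or.inl ⟨hF, by simp only [hμ, h0, Nat.cast_zero]⟩
    · exact Or.inr ⟨r, hr, by simp only [hμ, hN]⟩
  -- the start
  have hstart : (b, δ) ∈ Cl := by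
    refine ⟨hadm, rfl, hO, ?_⟩
    rcases hdata with hfull | ⟨j, hj0, hne, r, hr⟩
    · exact Or.inl ⟨ℓ, hℓ, hsupp, hfull⟩
    · exact Or.inr ⟨r, ℓ, j, hℓ, hsupp, hj0, hne, hr⟩
  refine DWinsTo.of_measure Cl μ ?_ hstart
  -- THE STEP: from `τ ∈ Cl`, play the identity point blow-up
  rintro ⟨bτ, δτ⟩ ⟨hadmτ, hheadτ, hOτ, hcase⟩ -
  dsimp only at hadmτ hheadτ hOτ hcase
  have hf : δτ.f ≠ 0 := hadmτ.2.1.ne_zero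
  have hoτ : δτ.o = δ.o := by
    have h := hheadτ
    rw [Decoration.head, Decoration.head, toLex_inj, Prod.mk.injEq] at h
    exact h.1
  have ho1 : 1 ≤ δτ.o := by omega
  have hperm := isBPermissible_point_X (k := k) δτ
  have hconv : ∀ (cc : Fin (2 + 1) → k) (l : Fin (2 + 1)), (fun _ : Fin (2 + 1) => (1 : ℕ)) l = 0 → cc l = 0 :=
    fun cc l hl => absurd hl one_ne_zero
  refine ⟨fun j => X j, fun _ => 1, hperm.1, ?_⟩
  intro c _ hc0 A G hfac hG
  obtain ⟨i, hci⟩ : ∃ i, c i ≠ 0 := Function.ne_iff.mp hc0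
  set δ' := δτ.transform (fun j => (X j : MvPowerSeries (Fin (2 + 1)) k)) (fun _ => 1) c i with hδ'
  have hadm' : Admissible (X 0 * TupleGame.slice i G) δ' := admissible_transform hadmτ hperm (hconv c) hfac hG hci
  have hhead' : δ'.head ≤ δτ.head := Decoration.head_transform_le hperm (hconv c) hf hci
  refine ⟨i, hci, (X 0 * TupleGame.slice i G, δ'), rfl, ?_⟩
  by_cases hlt : δ'.head < δτ.head
  · exact Or.inl ⟨hadm', Or.inl (by rw [← hheadτ]; exact hlt)⟩
  have heq : δ'.head = δτ.head := le_antisymm hhead' (not_lt.mp hlt)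
  have hO' : δ'.O = ∅ := Decoration.transform_O_eq_empty_of_head_eq hOτ heq
  have ho' : δ'.o = δτ.o := Decoration.o_transform_of_head_eq heq
  -- apex column: exit
  by_cases hH : δ'.HCol
  · exact Or.inl ⟨hadm', Or.inr ⟨by rw [heq, hheadτ], Or.inl hH⟩⟩
  -- otherwise a directrix form of the transform
  obtain ⟨ℓ', hℓ'⟩ := Decoration.exists_isDirForm_of_not_hCol hadm' (by rw [ho']; omega) hH
  -- the state's data, with the measure achieved
  rcases hμ_eq (bτ, δτ) hcase with ⟨⟨ℓτ, hℓτ, hsuppτ, hfullτ⟩, hμτ⟩ | ⟨r, ⟨ℓτ, j, hℓτ, hsuppτ, hj0, hneτ, hr⟩, hμτ⟩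
  · -- FULL SUPPORT: every same-head answer outside the apex column is in good position
    have hdot : dotProduct ℓτ c = 0 := dotProduct_answer_eq_zero hadmτ ho1 hci hadm' heq hℓτ
    -- some `l ≠ i` has `c_l ≠ 0` (else `ℓ_i c_i = 0`)
    obtain ⟨l, hli, hcl⟩ : ∃ l, l ≠ i ∧ c l ≠ 0 := by
      by_contra hnone
      push Not at hnone
      rw [dotProduct_eq_single_term (fun l hl _ => hnone l hl)] at hdot
      exact (mul_ne_zero (hfullτ i) hci) hdot
    obtain ⟨p, rfl⟩ := Fin.exists_succAbove_eq hli
    have hℓ'p : ℓ' p.succ ≠ 0 := fun h =>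
      hfullτ _ ((dirForm_transform_succ_eq_zero_iff hadmτ ho1 hci heq hℓτ hℓ' p).mp h)
    have hnot : p.succ ∉ δ'.E := fun h => hcl ((Decoration.succ_mem_transform_E_iff δτ _ hci p).mp h).2
    exact Or.inl ⟨hadm', Or.inr ⟨by rw [heq, hheadτ], Or.inr ⟨hO', ℓ', hℓ', p.succ, hnot, hℓ'p⟩⟩⟩
  · -- SUPPORT OF SIZE TWO with free letter `j` and failing level `r`
    have hdot : dotProduct ℓτ c = 0 := dotProduct_answer_eq_zero hadmτ ho1 hci hadm' heq hℓτ
    by_cases hex : ∃ l, l ≠ i ∧ ℓτ l ≠ 0 ∧ c l ≠ 0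
    · -- (a) a support letter other than the slot leaves: good position
      obtain ⟨l, hli, hℓl, hcl⟩ := hex
      obtain ⟨p, rfl⟩ := Fin.exists_succAbove_eq hli
      have hℓ'p : ℓ' p.succ ≠ 0 := fun h =>
        hℓl ((dirForm_transform_succ_eq_zero_iff hadmτ ho1 hci heq hℓτ hℓ' p).mp h)
      have hnot : p.succ ∉ δ'.E := fun h => hcl ((Decoration.succ_mem_transform_E_iff δτ _ hci p).mp h).2
      exact Or.inl ⟨hadm', Or.inr ⟨by rw [heq, hheadτ], Or.inr ⟨hO', ℓ', hℓ', p.succ, hnot, hℓ'p⟩⟩⟩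
    · -- (b) the axis point: `ℓ_i = 0`, `i = j`, `c = c_j e_j`
      push Not at hex
      have hℓi : ℓτ i = 0 := by
        by_contra hne
        rw [dotProduct_eq_single_term (fun l hl hℓl => hex l hl hℓl)] at hdot
        exact (mul_ne_zero hne hci) hdot
      have hij : i = j := by
        by_contra hne
        exact hneτ i hne hℓi
      subst hij
      have haxis : ∀ l, l ≠ i → c l = 0 := fun l hl => hex l hl (hneτ l hl)
      -- the transform: support letters `p⁺` (both non-zero, both boundary letters), maybe `s`
      have hℓ'succ : ∀ p : Fin 2, ℓ' p.succ ≠ 0 := fun p h =>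
        hneτ _ (Fin.succAbove_ne i p) ((dirForm_transform_succ_eq_zero_iff hadmτ ho1 hci heq hℓτ hℓ' p).mp h)
      have hsupp' : ∀ q, ℓ' q ≠ 0 → q ∈ δ'.E := by
        intro q hq
        rcases Fin.eq_zero_or_eq_succ q with rfl | ⟨p, rfl⟩
        · exact Decoration.zero_mem_transform_E δτ _ _ c i
        · have hl : ℓτ (i.succAbove p) ≠ 0 := hneτ _ (Fin.succAbove_ne i p)
          exact (Decoration.succ_mem_transform_E_iff δτ _ hci p).mpr ⟨hsuppτ _ hl, haxis _ (Fin.succAbove_ne i p)⟩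
      right
      by_cases hℓ'0 : ℓ' 0 = 0
      · -- `|S′| = 2`, free letter `s = 0`: the level drops by one
        have hr1 : 1 ≤ r := one_le_of_not_level hr
        -- the new equation is the sliced strict transform
        set Gf := satPart (δτ.fChart (fun j => (X j : MvPowerSeries (Fin (2 + 1)) k)) (fun _ => 1) c) with hGf
        have hfacf : subst (CobordantChart.chart (fun _ : Fin (2 + 1) => 1) c) δτ.f = X 0 ^ δτ.o * Gf := chart_f_eq hadmτ c
        have hf' : δ'.f = TupleGame.slice i Gf := by
          have h := totalO_transform_eq_slice hadmτ hci heq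
          rw [hO', hOτ, Finset.prod_empty, Finset.prod_empty, mul_one, mul_one] at h
          exact h
        have hlev' : ¬ (∀ E : Fin (2 + 1) →₀ ℕ, offDeg 0 E < δ'.o → E 0 < (r - 1) * (δ'.o - offDeg 0 E) → coeff E δ'.f = 0) := by
          rw [ho', hf']
          refine not_level_slice_of_not_level haxis hci (fun E hE => o_le_degree_of_coeff_ne_zero δτ hf hE) hfacf ?_
          rw [Nat.sub_add_cancel hr1]
          exact hr
        have hTwo' : Two (X 0 * TupleGame.slice i G, δ') (r - 1) :=
          ⟨ℓ', 0, hℓ', hsupp', hℓ'0, fun l hl => by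
            obtain ⟨p, rfl⟩ := Fin.exists_succ_eq.mpr hl
            exact hℓ'succ p, hlev'⟩
        refine ⟨⟨hadm', by rw [heq, hheadτ], hO', Or.inr ⟨r - 1, hTwo'⟩⟩, ?_⟩
        calc μ (X 0 * TupleGame.slice i G, δ') ≤ ((r - 1 + 1 : ℕ) : Ordinal.{0}) := hμ_le_Two _ _ hTwo'
          _ < ((r + 1 : ℕ) : Ordinal.{0}) := Nat.cast_lt.mpr (by omega)
          _ = μ (bτ, δτ) := hμτ.symm
      · -- `|S′| = 3`: measure `0`
        have hFull' : Full (X 0 * TupleGame.slice i G, δ') :=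
          ⟨ℓ', hℓ', hsupp', fun q => by
            rcases Fin.eq_zero_or_eq_succ q with rfl | ⟨p, rfl⟩
            · exact hℓ'0
            · exact hℓ'succ p⟩
        refine ⟨⟨hadm', by rw [heq, hheadτ], hO', Or.inl hFull'⟩, ?_⟩
        calc μ (X 0 * TupleGame.slice i G, δ') = 0 := hμ_le_Full _ hFull'
          _ < ((r + 1 : ℕ) : Ordinal.{0}) := Nat.cast_lt.mpr (Nat.succ_pos r) |>.trans_eq' (Nat.cast_zero).symm
          _ = μ (bτ, δτ) := hμτ.symm

end NCResBad

end TameFourTupleDrop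

end Summit.ResolutionOfSingularities.ResolutionOfSingularities.Theorems

end
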